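/-
# `Balaban1983to89.B5SupCertsTorus` — Bałaban CMP 95 (1984), Proposition 1.2, step S1 AS PRINTED on the torus of record:
# THE FOUR DOMINATION CERTIFICATES `certSup` / `certH1` / `certE4` / `certH2` OF `B5SupWalkS1.SupRealisation` FOR THE
# SETTING OF RECORD `latticeSettingP12R n M a k`, and the realisation constructor from the two representations

statement-level skeleton of published theorems with citation tags; proofs where landed; nothing here is a claim
about the Yang–Mills mass gap

CITATION HEADER (lean-in-tree rule).  Cell `lit-balaban`, unit `lit-balaban-p38` (Phase-2 proof seat p38 gen 8), HOME
`run/shared/lean/pub/lit-balaban/` (SKELETON rows B5.Eq1.110–1.113 (walk side), B5.Eq1.131, B5.Prop1.2; owner r02).  B5 =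
T. Bałaban, *Propagators and renormalization transformations for lattice gauge theories. I*, Commun. Math. Phys. **95** (1984)
17–40 [`Balaban1984PropagatorsI`], held as `paper:balaban1984-cmp95-propagators-rt-i` (journal page = PDF page + 16).  FILE D₂
(last of the p38-gen-8 half = the DomCert side) of the sup/Hölder (S1) torus instantiation of `B5SupWalkS1.SupRealisation`
(B5-CLOSURE §5 item 2); FILES A/B/C/C′/D₁ = `B5SupCarrierTorus` / `B5SupHolderTorus` / `B5SupFactor125Torus` /
`B5SupFactor129AdjTorus` / `B5SupDominatedTorus`; the representation records (`Rep`: (1.115) + (1.126) ⇒ (1.128) on the two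
carriers) are r02՚s `B5SupRepTorus.repS` (direct) and the adjoint twin (ℓ¹ (1.128)).

WHAT IS PRINTED (pp. 35–39 [PDF 19–23]).  Prop. 1.2 (1.110)–(1.113) pp. 35–36; the walk (1.123) p. 37 and its estimates
(1.125), (1.129)–(1.131) p. 38 (the sum in (1.131) running over ω = (ω₀, …, ω_n) with y ∈ □_{ω₀}, y′ ∈ □_{ω_n}); p. 39 L1–3:
«Let us notice that the constant O(1) under the sum above is an absolute constant depending on d only, hence we can fix M₀
depending on d only, such that the series is convergent.»; p. 39 L6–8: «The proofs of the other inequalities are exactly the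
same, but in the estimates of G∇*J we have to take a representation of G adjoint to (1.123), with the operators K(h) acting
on the right.»

WHAT THIS MODULE PROVES (kernel-checked, zero sorry).
§1 the two-carrier family `CarV/CarVg : Bool → Type` (`true ↦ ℓ^∞ = VecR`, `false ↦ ℓ¹ = V1`) with its instances, and
   `repPair ρd ρa : ∀ r, Rep … (CarV r) (CarVg r) …` pairing a direct and an adjoint representation; DomCert packaging over a
   finite index (`domCert_of_family`, `domCert_zero`);
§2 **`certSup_holds`, `certH1_holds`, `certE4_holds`, `certH2_holds`**: the four `DomCert` fields of `SupRealisation` for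
   `St = latticeSettingP12R n M a k`, `g = gP12R`, centres `B5WalkTorusGeom.ctr M M₀` (`M₀ ≥ 1`), for ANY pair of representations
   whose operators ARE the operators of record (`ρd.G = Gs`, `ρd.H = Hs`, `ρd.Dg = Dgs`; `ρa.G = G1`, `ρa.H = H1`, `ρa.Dg = Dg1`) and
   ANY `κ` with `11/3 ≤ c̄`, `cFmax ≤ c_F`, `cLmax ≤ c_L`, `c1max ≤ c₁`: every typed entry — by cases on the source kind (vector /
   tensor / 2-tensor) and the entry index — is certified by the finitely many dominated problems of FILE D₁ (one per point of
   `Δ̃(y)` for the sup entries, one per admissible pair for the Hölder entries; the `G∇*J` entries on the adjoint carrier; null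
   problems for the vanishing entries of the typed table);
§3 **`supRealisationR`**: the `SupRealisation` of the setting of record assembled from `ρd`, `ρa`, the four certificates and the
   gen-7 cube geometry (`card_near_ctr_le`, `rowSum_ctr_le`), for `κ` with moreover `(8c̄+1)^d ≤ ν`, `K_d(¼) ≤ K̄`.

HONEST SCOPE / DIVERGENCE.  (1) This file proves NO analytic estimate: it is the bookkeeping «finitely many walk problems per
entry» of pp. 37–39 over FILE D₁.  (2) The representations are INPUTS (records built elsewhere from (1.115) and the sup / ℓ¹
(1.128)); nothing is assumed about them beyond their operators being those of record.  (3) Constants d-only, ours.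
CELL BOOK-KEEPING (lit-balaban): rows B5.Eq1.131 / B5.Prop1.2 («S1 torus instantiation: the DomCert half landed; SupRealisation
modulo the two Rep records»), B5.Eq1.110–1.113 cells (walk-side certificates) — cells only, NO head change; NOT summit progress.
-/
import Mathlib
import Literature.MathematicalPhysics.QuantumFieldTheory.Balaban1983to89.B5SupDominatedTorus

open Finset

namespace Literature.MathematicalPhysics.QuantumFieldTheory.Balaban1983to89.B5SupCertsTorus

open scoped BigOperators Matrix
open WithLp
open Literature.MathematicalPhysics.QuantumFieldTheory.Balaban1983to89
open Literature.MathematicalPhysics.QuantumFieldTheory.Balaban1983to89.B5SupWalk125 (size)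
open Literature.MathematicalPhysics.QuantumFieldTheory.Balaban1983to89.B5SupWalk131 (SupConsts env Adm Dominated)
open Literature.MathematicalPhysics.QuantumFieldTheory.Balaban1983to89.B5SupWalkS1 (Rep DomCert SupRealisation)
open Literature.MathematicalPhysics.QuantumFieldTheory.Balaban1983to89.B5Prop11Plancherel (Tor fine)
open Literature.MathematicalPhysics.QuantumFieldTheory.Balaban1983to89.B5Prop12FieldsLattice (distU distSite cubeT cubeB holderV
  holderT holderL supNormL cutSupL cutHL cutInL smulV smulT distU_nonneg supNormL_nonneg holderL_nonneg cutHL_nonneg)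
open Literature.MathematicalPhysics.QuantumFieldTheory.Balaban1983to89.B5RealFields (GR fdiffR gradR divTR LapR cplx cplx_GR_mulVec
  cplx_gradR cplx_divTR)
open Literature.MathematicalPhysics.QuantumFieldTheory.Balaban1983to89.B5SettingP12Real (LocR VecR latticeSettingP12R gP12R)
open Literature.MathematicalPhysics.QuantumFieldTheory.Balaban1983to89.B5WalkTorusGeom (TorR sitePt Cen ctr distSite_le_dist_sitePt
  card_near_ctr_le rowSum_ctr_le)
open Literature.MathematicalPhysics.QuantumFieldTheory.Balaban1983to89.B5WalkCarrierTorus (Bnd)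
open Literature.MathematicalPhysics.QuantumFieldTheory.Balaban1983to89.B4Sect5Proof (latticeConst)
open Literature.MathematicalPhysics.QuantumFieldTheory.Balaban1983to89.B5Prop11Lattice (grad divT)
open Literature.MathematicalPhysics.QuantumFieldTheory.Balaban1983to89.B5Prop11Lower (Lap)
open Literature.MathematicalPhysics.QuantumFieldTheory.Balaban1983to89.B5DeltaA169 (DeltaA)
open Literature.MathematicalPhysics.QuantumFieldTheory.Balaban1983to89.B5SupCarrierTorus (Gs Hs Dgs V1 Vg1 G1 H1 Dg1
  setting_supNorm_vec setting_supNorm_ten)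
open Literature.MathematicalPhysics.QuantumFieldTheory.Balaban1983to89.B5SupHolderTorus (holS holS_nonneg cutHL_eq abs_le_cutSupL)
open Literature.MathematicalPhysics.QuantumFieldTheory.Balaban1983to89.B5SupFactor125Torus (cplx_LapR_mulVec)
open Literature.MathematicalPhysics.QuantumFieldTheory.Balaban1983to89.B5SupFactor129AdjTorus (mono cutSrc)
open Literature.MathematicalPhysics.QuantumFieldTheory.Balaban1983to89.B5SupDominatedTorus (cFmax cLmax c1max one_le_env
  dominated_zero dominated_eval dominated_grad dominated_lap dominated_quotH_vec dominated_grad_ten dominated_quotH_ten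
  dominated_eval_adj dominated_quotH_adj)

noncomputable section

variable {d : ℕ}

/-! ## §1 The two-carrier family and the packaging of certificates -/

section Family

variable (n : ℕ) [NeZero n] (M : Fin d → ℕ) [hM : ∀ μ, NeZero (M μ)]

/-- the carriers of the two representations of p. 39: `true ↦` the direct walk (1.123) on `ℓ^∞` (`VecR`), `false ↦` the adjoint
walk on `ℓ¹` (`V1`). [cite: Balaban1984PropagatorsI, (1.123) p.37, p.39 L7–9] -/
def CarV : Bool → Type
  | true => VecR n M
  | false => V1 n M

/-- the gradient-value carriers of the two representations. [cite: Balaban1984PropagatorsI, (1.108) p.35, p.39 L7–9] -/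
def CarVg : Bool → Type
  | true => Fin d → VecR n M
  | false => Vg1 n M

/-- the norms of the two carriers (`ℓ^∞`, `ℓ¹`). [cite: Balaban1984PropagatorsI, (1.108) p.35, p.39 L7–9] -/
instance instCarVNorm (r : Bool) : SeminormedAddCommGroup (CarV n M r) :=
  match r with
  | true => inferInstanceAs (SeminormedAddCommGroup (VecR n M))
  | false => inferInstanceAs (SeminormedAddCommGroup (V1 n M))

/-- the real module structures of the two carriers. [cite: Balaban1984PropagatorsI, (1.123) p.37, p.39 L7–9] -/
instance instCarVMod (r : Bool) : Module ℝ (CarV n M r) :=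
  match r with
  | true => inferInstanceAs (Module ℝ (VecR n M))
  | false => inferInstanceAs (Module ℝ (V1 n M))

/-- the norms of the two gradient-value carriers. [cite: Balaban1984PropagatorsI, (1.108) p.35, p.39 L7–9] -/
instance instCarVgNorm (r : Bool) : SeminormedAddCommGroup (CarVg n M r) :=
  match r with
  | true => inferInstanceAs (SeminormedAddCommGroup (Fin d → VecR n M))
  | false => inferInstanceAs (SeminormedAddCommGroup (Vg1 n M))

/-- the real module structures of the two gradient-value carriers. [cite: Balaban1984PropagatorsI, (1.108) p.35] -/
instance instCarVgMod (r : Bool) : Module ℝ (CarVg n M r) :=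
  match r with
  | true => inferInstanceAs (Module ℝ (Fin d → VecR n M))
  | false => inferInstanceAs (Module ℝ (Vg1 n M))

variable {n M} {a : ℝ} {M₀ : ℕ} {k : ℕ} {kd : B5.KernelData} {κ : SupConsts}

/-- **the family of representations of p. 39**: a direct one (`true`) and an adjoint one (`false`).
[cite: Balaban1984PropagatorsI, (1.123) p.37, p.39 L7–9] -/
def repPair (ρd : Rep (latticeSettingP12R n M a k) kd (gP12R M n a k) M₀ κ (VecR n M) (Fin d → VecR n M) (TorR M) (Cen M M₀)
      (ctr M M₀))
    (ρa : Rep (latticeSettingP12R n M a k) kd (gP12R M n a k) M₀ κ (V1 n M) (Vg1 n M) (TorR M) (Cen M M₀) (ctr M M₀)) :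
    ∀ r : Bool, Rep (latticeSettingP12R n M a k) kd (gP12R M n a k) M₀ κ (CarV n M r) (CarVg n M r) (TorR M) (Cen M M₀) (ctr M M₀)
  | true => ρd
  | false => ρa

end Family

section Pack

variable {St : B5.Setting} {kd : B5.KernelData} {g : B5.GlobalH St} {M₀ : ℕ} {κ : SupConsts}
  {R : Type} {V Vg : R → Type} [∀ r, SeminormedAddCommGroup (V r)] [∀ r, Module ℝ (V r)]
  [∀ r, SeminormedAddCommGroup (Vg r)] [∀ r, Module ℝ (Vg r)]
  {X : Type} [PseudoMetricSpace X] {S : Type} [Fintype S]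

/-- **a certificate from a finite family of dominated problems** («we estimate the norm … by the sum of norms», p. 38 l.1–2; the
`Fin n`-indexing of `DomCert` from any `Fintype` index). [cite: Balaban1984PropagatorsI, (1.131) p.38, p.39] -/
theorem domCert_of_family (ctr : S → X) (rep : ∀ r : R, Rep St kd g M₀ κ (V r) (Vg r) X S ctr) {A s₁ m₁ t q : ℝ}
    {ι : Type} [Fintype ι] (qv : ι → ℝ) (hs : 0 ≤ s₁) (hm : 0 ≤ m₁)
    (hprob : ∀ i : ι, ∃ (r : R) (u u' : X) (src : V r), t ≤ dist u u' ∧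
      Dominated (rep r).G (rep r).H (rep r).Dg ctr (κ.cbar * M₀) κ A s₁ m₁ u u' src (qv i))
    (hq : ∀ B : ℝ, 0 ≤ B → (∀ i, qv i ≤ B) → q ≤ B) : DomCert ctr rep A s₁ m₁ t q := by
  refine ⟨hs, hm, Fintype.card ι, qv ∘ (Fintype.equivFin ι).symm, fun j => hprob _, fun B hB h => hq B hB fun i => ?_⟩
  have := h (Fintype.equivFin ι i)
  simpa only [Function.comp_apply, Equiv.symm_apply_apply] using this

/-- the certificate of a vanishing entry (no problems). [cite: Balaban1984PropagatorsI, (1.131) p.38] -/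
theorem domCert_zero (ctr : S → X) (rep : ∀ r : R, Rep St kd g M₀ κ (V r) (Vg r) X S ctr) {A s₁ m₁ t : ℝ}
    (hs : 0 ≤ s₁) (hm : 0 ≤ m₁) : DomCert ctr rep A s₁ m₁ t 0 :=
  ⟨hs, hm, 0, Fin.elim0, fun j => Fin.elim0 j, fun _ hB _ => hB⟩

end Pack

/-! ## §2 The four certificates for the setting of record -/

section Certs

variable {n : ℕ} [NeZero n] {M : Fin d → ℕ} [hM : ∀ μ, NeZero (M μ)] {a : ℝ} {M₀ : ℕ} {k : ℕ} {kd : B5.KernelData}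
  (κ : SupConsts)
  (ρd : Rep (latticeSettingP12R n M a k) kd (gP12R M n a k) M₀ κ (VecR n M) (Fin d → VecR n M) (TorR M) (Cen M M₀) (ctr M M₀))
  (ρa : Rep (latticeSettingP12R n M a k) kd (gP12R M n a k) M₀ κ (V1 n M) (Vg1 n M) (TorR M) (Cen M M₀) (ctr M M₀))

/-- `b ∈ cubeB y ↔ b.1 ∈ Δ̃(y)`. [cite: Balaban1984PropagatorsI, (1.110) p.35 (x ∈ Δ̃(y))] -/
theorem mem_cubeB_iff {y : Tor M} {b : Bnd n M} : b ∈ cubeB n M y ↔ b.1 ∈ cubeT n M y := by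
  unfold cubeB; rw [Finset.mem_product]; simp only [Finset.mem_univ, and_true]

/-- the support of a real vector source from the typed `supp J ⊂ Δ̃(y′)`. [cite: Balaban1984PropagatorsI, Prop. 1.2 p.35] -/
theorem supp_vec {J : VecR n M} {y' : Tor M} (h : (latticeSettingP12R n M a k).suppIn (LocR.vec J) y') :
    ∀ c, J c ≠ 0 → c.1 ∈ cubeT n M y' := fun c hc => h c (by dsimp only; exact_mod_cast hc)

/-- the support of a real tensor source from the typed `supp J ⊂ Δ̃(y′)`. [cite: Balaban1984PropagatorsI, Prop. 1.2 p.35] -/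
theorem supp_ten {T : Fin d → VecR n M} {y' : Tor M} (h : (latticeSettingP12R n M a k).suppIn (LocR.ten T) y') :
    ∀ ν c, T ν c ≠ 0 → c.1 ∈ cubeT n M y' := fun ν c hc => h ν c (by dsimp only; exact_mod_cast hc)

/-- `∇*0 = 0`. [cite: Balaban1984PropagatorsI, (1.31) p.23] -/
theorem divTR_zero : divTR n M (0 : Fin d → VecR n M) = 0 := by
  unfold divTR; simp only [Pi.zero_apply, Matrix.mulVec_zero, Finset.sum_const_zero]

/-- `‖ζ‖_α + |ζ| = 0 ⇒ ζ = 0`. [cite: Balaban1984PropagatorsI, Prop. 1.2 (1.111) p.35] -/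
theorem cut_eq_zero_of_cutHL {α : ℝ} {ζ : Tor (fine n M) → ℝ} (h : cutHL n M α ζ = 0) (x : Tor (fine n M)) : ζ x = 0 := by
  have h1 := abs_le_cutSupL ζ x
  have h2 := holS_nonneg (n := n) (M := M) α ζ
  rw [cutHL_eq] at h
  exact abs_eq_zero.mp (le_antisymm (by linarith) (abs_nonneg _))

/-- `(t^α)⁻¹|X| ≤ B ⇒ |X| ≤ B·t^α`. [cite: Balaban1984PropagatorsI, (1.109) p.35] -/
theorem le_mul_rpow_of_inv_mul_le {t α X B : ℝ} (ht : 0 < t) (h : (t ^ α)⁻¹ * |X| ≤ B) : |X| ≤ B * t ^ α := by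
  have hp : 0 < t ^ α := Real.rpow_pos_of_pos ht α
  have := mul_le_mul_of_nonneg_left h hp.le
  rwa [← mul_assoc, mul_inv_cancel₀ hp.ne', one_mul, mul_comm] at this

/-- **`certSup` FOR THE SETTING OF RECORD**: every sup entry (1.110) — `|GJ|, |∇GJ|, |ΔGJ|` (vector source, direct walk),
`|G∇*J|` (tensor source, adjoint walk), `0` elsewhere in the typed table — is certified. [cite: Balaban1984PropagatorsI, (1.110) p.35, (1.123) p.37, (1.125), (1.129)–(1.131) p.38, p.39] -/
theorem certSup_holds (hGd : ρd.G = Gs n M a) (hHd : ρd.H = Hs n M M₀) (hDd : ρd.Dg = Dgs n M)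
    (hGa : ρa.G = G1 n M a) (hHa : ρa.H = H1 n M M₀) (hDa : ρa.Dg = Dg1 n M)
    (hn : 1 ≤ n) (ha : 0 < a) (hM₀ : 1 ≤ M₀)
    (hcb : 11 / 3 ≤ κ.cbar) (hcF : cFmax d ≤ κ.cF) (hcL : cLmax d ≤ κ.cL) (hc1 : c1max d ≤ κ.c1) :
    ∀ (C : ℝ) (Cα Cε : ℝ → ℝ) (Cαε : ℝ → ℝ → ℝ), 0 < C →
      B5.Global115_117 (latticeSettingP12R n M a k) (gP12R M n a k) C Cα Cε Cαε →
      ∀ (m : Fin 4) (J : (latticeSettingP12R n M a k).Loc) (y y' : (latticeSettingP12R n M a k).Site),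
        (latticeSettingP12R n M a k).suppIn J y' →
        DomCert (ctr M M₀) (repPair ρd ρa) (env C 0 0 0 0) 1 ((latticeSettingP12R n M a k).supNorm J)
          ((latticeSettingP12R n M a k).dist y y') ((latticeSettingP12R n M a k).e m J y) := by
  intro C Cα Cε Cαε hC hG m J y y' hJ
  have hA : 0 ≤ env C 0 0 0 0 := le_trans zero_le_one (one_le_env C 0 0 0 0)
  have hm0 : 0 ≤ (latticeSettingP12R n M a k).supNorm J := supNormL_nonneg _
  have hdist : (latticeSettingP12R n M a k).dist y y' ≤ dist (sitePt M y) (sitePt M y') := distSite_le_dist_sitePt M y y'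
  have hdist' : (latticeSettingP12R n M a k).dist y y' ≤ dist (sitePt M y') (sitePt M y) := by rw [dist_comm]; exact hdist
  cases J with
  | vec Jv =>
    have hJ' := supp_vec (k := k) hJ
    rw [setting_supNorm_vec]
    fin_cases m
    · -- `|GJ|`
      refine domCert_of_family _ _ (ι := Bnd n M) (fun b => if b.1 ∈ cubeT n M y then |(GR n M a *ᵥ Jv) b| else 0)
        zero_le_one (norm_nonneg Jv) (fun b => ?_) ?_
      · by_cases hb : b.1 ∈ cubeT n M y
        · refine ⟨true, sitePt M y, sitePt M y', Jv, hdist, ?_⟩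
          rw [if_pos hb]
          show Dominated ρd.G ρd.H ρd.Dg (ctr M M₀) (κ.cbar * M₀) κ _ _ _ _ _ Jv _
          rw [hGd, hHd, hDd]
          exact dominated_eval k κ hn hM₀ hC hG hcb hcF hcL hc1 hJ' hb
        · refine ⟨true, sitePt M y, sitePt M y', 0, hdist, ?_⟩
          rw [if_neg hb]
          exact dominated_zero _ _ _ _ _ κ _ _ zero_le_one (norm_nonneg Jv) hA
      · intro B hB h
        show LatticeNorms.supNorm (cubeB n M y) ((DeltaA n M a)⁻¹ *ᵥ cplx Jv) ≤ B
        rw [← cplx_GR_mulVec]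
        refine LatticeNorms.supNorm_le hB fun b hb => ?_
        have hb1 : b.1 ∈ cubeT n M y := mem_cubeB_iff.mp hb
        have := h b
        rw [if_pos hb1] at this
        show ‖(((GR n M a *ᵥ Jv) b : ℝ) : ℂ)‖ ≤ B
        rwa [Complex.norm_real, Real.norm_eq_abs]
    · -- `|∇GJ|`
      refine domCert_of_family _ _ (ι := Fin d × Bnd n M)
        (fun p => if p.2.1 ∈ cubeT n M y then |gradR n M (GR n M a *ᵥ Jv) p.1 p.2| else 0)
        zero_le_one (norm_nonneg Jv) (fun p => ?_) ?_
      · by_cases hb : p.2.1 ∈ cubeT n M y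
        · refine ⟨true, sitePt M y, sitePt M y', Jv, hdist, ?_⟩
          rw [if_pos hb]
          show Dominated ρd.G ρd.H ρd.Dg (ctr M M₀) (κ.cbar * M₀) κ _ _ _ _ _ Jv _
          rw [hGd, hHd, hDd]
          exact dominated_grad k κ hn hM₀ hC hG hcb hcF hcL hc1 hJ' p.1 hb
        · refine ⟨true, sitePt M y, sitePt M y', 0, hdist, ?_⟩
          rw [if_neg hb]
          exact dominated_zero _ _ _ _ _ κ _ _ zero_le_one (norm_nonneg Jv) hA
      · intro B hB h
        show LatticeNorms.supNorm (Finset.univ ×ˢ cubeB n M y)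
          (fun p : Fin d × (Tor (fine n M) × Fin d) =>
            grad n M ((DeltaA n M a)⁻¹ *ᵥ cplx Jv) p.1 p.2) ≤ B
        refine LatticeNorms.supNorm_le hB fun p hp => ?_
        have hb1 : p.2.1 ∈ cubeT n M y := mem_cubeB_iff.mp (Finset.mem_product.mp hp).2
        have := h p
        rw [if_pos hb1] at this
        show ‖grad n M ((DeltaA n M a)⁻¹ *ᵥ cplx Jv) p.1 p.2‖ ≤ B
        rw [← cplx_GR_mulVec, ← cplx_gradR]
        show ‖((gradR n M (GR n M a *ᵥ Jv) p.1 p.2 : ℝ) : ℂ)‖ ≤ B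
        rwa [Complex.norm_real, Real.norm_eq_abs]
    · -- `|G∇*J|` vanishes on the vector summand of the typed table
      exact domCert_zero _ _ zero_le_one (norm_nonneg Jv)
    · -- `|ΔGJ|`
      refine domCert_of_family _ _ (ι := Bnd n M)
        (fun b => if b.1 ∈ cubeT n M y then |(LapR n M *ᵥ (GR n M a *ᵥ Jv)) b| else 0)
        zero_le_one (norm_nonneg Jv) (fun b => ?_) ?_
      · by_cases hb : b.1 ∈ cubeT n M y
        · refine ⟨true, sitePt M y, sitePt M y', Jv, hdist, ?_⟩
          rw [if_pos hb]
          show Dominated ρd.G ρd.H ρd.Dg (ctr M M₀) (κ.cbar * M₀) κ _ _ _ _ _ Jv _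
          rw [hGd, hHd, hDd]
          exact dominated_lap k κ hn hM₀ hC hG hcb hcF hcL hc1 hJ' hb
        · refine ⟨true, sitePt M y, sitePt M y', 0, hdist, ?_⟩
          rw [if_neg hb]
          exact dominated_zero _ _ _ _ _ κ _ _ zero_le_one (norm_nonneg Jv) hA
      · intro B hB h
        show LatticeNorms.supNorm (cubeB n M y)
          (Lap n M *ᵥ ((DeltaA n M a)⁻¹ *ᵥ cplx Jv)) ≤ B
        rw [← cplx_GR_mulVec, ← cplx_LapR_mulVec]
        refine LatticeNorms.supNorm_le hB fun b hb => ?_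
        have hb1 : b.1 ∈ cubeT n M y := mem_cubeB_iff.mp hb
        have := h b
        rw [if_pos hb1] at this
        show ‖(((LapR n M *ᵥ (GR n M a *ᵥ Jv)) b : ℝ) : ℂ)‖ ≤ B
        rwa [Complex.norm_real, Real.norm_eq_abs]
  | ten T =>
    have hT' := supp_ten (k := k) hJ
    rw [setting_supNorm_ten]
    fin_cases m
    · exact domCert_zero _ _ zero_le_one (norm_nonneg T)
    · exact domCert_zero _ _ zero_le_one (norm_nonneg T)
    · -- `|G∇*J|` on the ADJOINT representation
      refine domCert_of_family _ _ (ι := Bnd n M)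
        (fun b => if b.1 ∈ cubeT n M y then |(GR n M a *ᵥ divTR n M T) b| else 0)
        zero_le_one (norm_nonneg T) (fun b => ?_) ?_
      · by_cases hb : b.1 ∈ cubeT n M y
        · by_cases hT0 : ‖T‖ = 0
          · have hT00 : T = 0 := norm_eq_zero.mp hT0
            refine ⟨true, sitePt M y, sitePt M y', 0, hdist, ?_⟩
            rw [if_pos hb, hT00, divTR_zero, Matrix.mulVec_zero, Pi.zero_apply, abs_zero]
            exact dominated_zero _ _ _ _ _ κ _ _ zero_le_one (norm_nonneg _) hA
          · refine ⟨false, sitePt M y', sitePt M y, toLp 1 (‖T‖ • mono n M b), hdist', ?_⟩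
            rw [if_pos hb]
            show Dominated ρa.G ρa.H ρa.Dg (ctr M M₀) (κ.cbar * M₀) κ _ _ _ _ _ (toLp 1 (‖T‖ • mono n M b)) _
            rw [hGa, hHa, hDa]
            exact dominated_eval_adj k κ hn ha hM₀ hC hG hcb hcF hcL hc1 hT' hT0 hb
        · refine ⟨true, sitePt M y, sitePt M y', 0, hdist, ?_⟩
          rw [if_neg hb]
          exact dominated_zero _ _ _ _ _ κ _ _ zero_le_one (norm_nonneg T) hA
      · intro B hB h
        show LatticeNorms.supNorm (cubeB n M y)
          ((DeltaA n M a)⁻¹ *ᵥ divT n M (fun ν => cplx (T ν))) ≤ B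
        rw [← cplx_divTR, ← cplx_GR_mulVec]
        refine LatticeNorms.supNorm_le hB fun b hb => ?_
        have hb1 : b.1 ∈ cubeT n M y := mem_cubeB_iff.mp hb
        have := h b
        rw [if_pos hb1] at this
        show ‖(((GR n M a *ᵥ divTR n M T) b : ℝ) : ℂ)‖ ≤ B
        rwa [Complex.norm_real, Real.norm_eq_abs]
    · exact domCert_zero _ _ zero_le_one (norm_nonneg T)
  | ten2 T2 =>
    exact domCert_zero _ _ zero_le_one hm0

/-- **`certH1` FOR THE SETTING OF RECORD**: (1.111) — `‖ζ∇GJ‖_α` (vector source, direct walk, one problem per admissible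
pair) and `‖ζG∇*J‖_α` (tensor source, ADJOINT walk), `0` on 2-tensors. [cite: Balaban1984PropagatorsI, (1.111) p.35, (1.123) p.37, (1.125), (1.129)–(1.131) p.38, p.39] -/
theorem certH1_holds (hGd : ρd.G = Gs n M a) (hHd : ρd.H = Hs n M M₀) (hDd : ρd.Dg = Dgs n M)
    (hGa : ρa.G = G1 n M a) (hHa : ρa.H = H1 n M M₀) (hDa : ρa.Dg = Dg1 n M)
    (hn : 1 ≤ n) (ha : 0 < a) (hM₀ : 1 ≤ M₀)
    (hcb : 11 / 3 ≤ κ.cbar) (hcF : cFmax d ≤ κ.cF) (hcL : cLmax d ≤ κ.cL) (hc1 : c1max d ≤ κ.c1) :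
    ∀ (C : ℝ) (Cα Cε : ℝ → ℝ) (Cαε : ℝ → ℝ → ℝ), 0 < C →
      B5.Global115_117 (latticeSettingP12R n M a k) (gP12R M n a k) C Cα Cε Cαε →
      ∀ (α : ℝ) (J : (latticeSettingP12R n M a k).Loc) (ζ : (latticeSettingP12R n M a k).Cut)
        (y y' : (latticeSettingP12R n M a k).Site), 0 ≤ α → α < 1 →
        (latticeSettingP12R n M a k).cutIn ζ y → (latticeSettingP12R n M a k).suppIn J y' →
        DomCert (ctr M M₀) (repPair ρd ρa) (env C (Cα α) 0 0 0) ((latticeSettingP12R n M a k).cutH α ζ)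
          ((latticeSettingP12R n M a k).supNorm J) ((latticeSettingP12R n M a k).dist y y')
          ((latticeSettingP12R n M a k).h1 J α ζ) := by
  intro C Cα Cε Cαε hC hG α J ζ y y' hα0 hα1 hζ hJ
  have hA : 0 ≤ env C (Cα α) 0 0 0 := le_trans zero_le_one (one_le_env C (Cα α) 0 0 0)
  have hm0 : 0 ≤ (latticeSettingP12R n M a k).supNorm J := supNormL_nonneg _
  have hs : 0 ≤ (latticeSettingP12R n M a k).cutH α ζ := cutHL_nonneg α ζ
  have hdist : (latticeSettingP12R n M a k).dist y y' ≤ dist (sitePt M y) (sitePt M y') := distSite_le_dist_sitePt M y y'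
  have hdist' : (latticeSettingP12R n M a k).dist y y' ≤ dist (sitePt M y') (sitePt M y) := by rw [dist_comm]; exact hdist
  have hζ' : cutInL n M ζ y := hζ
  cases J with
  | vec Jv =>
    have hJ' := supp_vec (k := k) hJ
    rw [setting_supNorm_vec]
    refine domCert_of_family _ _ (ι := (Fin d × Bnd n M) × (Fin d × Bnd n M))
      (fun pp => if pp.1.1 = pp.2.1 ∧ pp.1.2.2 = pp.2.2.2 ∧ distU n M pp.1.2.1 pp.2.2.1 ≤ 1 ∧ 0 < distU n M pp.1.2.1 pp.2.2.1
        then (distU n M pp.1.2.1 pp.2.2.1 ^ α)⁻¹ * |ζ pp.2.2.1 * gradR n M (GR n M a *ᵥ Jv) pp.1.1 (pp.2.2.1, pp.1.2.2)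
          - ζ pp.1.2.1 * gradR n M (GR n M a *ᵥ Jv) pp.1.1 (pp.1.2.1, pp.1.2.2)| else 0)
      hs (norm_nonneg Jv) (fun pp => ?_) ?_
    · by_cases hadm : pp.1.1 = pp.2.1 ∧ pp.1.2.2 = pp.2.2.2 ∧ distU n M pp.1.2.1 pp.2.2.1 ≤ 1 ∧ 0 < distU n M pp.1.2.1 pp.2.2.1
      · refine ⟨true, sitePt M y, sitePt M y', Jv, hdist, ?_⟩
        rw [if_pos hadm]
        show Dominated ρd.G ρd.H ρd.Dg (ctr M M₀) (κ.cbar * M₀) κ _ _ _ _ _ Jv _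
        rw [hGd, hHd, hDd]
        exact dominated_quotH_vec k κ hn hM₀ hC hG hcb hcF hcL hc1 hJ' hα0 hα1 hζ' pp.1.1 pp.1.2.2 hadm.2.2.1 hadm.2.2.2
      · refine ⟨true, sitePt M y, sitePt M y', 0, hdist, ?_⟩
        rw [if_neg hadm]
        exact dominated_zero _ _ _ _ _ κ _ _ hs (norm_nonneg Jv) hA
    · intro B hB h
      show holderT n M α (smulT n M ζ (grad n M ((DeltaA n M a)⁻¹ *ᵥ cplx Jv))) ≤ B
      unfold holderT LatticeNorms.holderSeminormB5
      refine LatticeNorms.holderSeminorm_le hB ?_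
      rintro ⟨ν, x, μ⟩ - ⟨ν', x', μ'⟩ - ⟨⟨hν, hμ⟩, h1⟩ h0
      simp only at hν hμ h1 h0
      subst hν hμ
      have hi := h ((ν, (x, μ)), (ν, (x', μ)))
      rw [if_pos ⟨rfl, rfl, h1, h0⟩] at hi
      show ‖(ζ x' : ℂ) * grad n M ((DeltaA n M a)⁻¹ *ᵥ cplx Jv) ν (x', μ)
        - (ζ x : ℂ) * grad n M ((DeltaA n M a)⁻¹ *ᵥ cplx Jv) ν (x, μ)‖
        ≤ B * distU n M x x' ^ α
      rw [← cplx_GR_mulVec, ← cplx_gradR]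
      show ‖(ζ x' : ℂ) * ((gradR n M (GR n M a *ᵥ Jv) ν (x', μ) : ℝ) : ℂ)
        - (ζ x : ℂ) * ((gradR n M (GR n M a *ᵥ Jv) ν (x, μ) : ℝ) : ℂ)‖ ≤ B * distU n M x x' ^ α
      rw [show (ζ x' : ℂ) * ((gradR n M (GR n M a *ᵥ Jv) ν (x', μ) : ℝ) : ℂ)
          - (ζ x : ℂ) * ((gradR n M (GR n M a *ᵥ Jv) ν (x, μ) : ℝ) : ℂ)
          = ((ζ x' * gradR n M (GR n M a *ᵥ Jv) ν (x', μ) - ζ x * gradR n M (GR n M a *ᵥ Jv) ν (x, μ) : ℝ) : ℂ) by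
          push_cast; ring, Complex.norm_real, Real.norm_eq_abs]
      exact le_mul_rpow_of_inv_mul_le h0 hi
  | ten T =>
    have hT' := supp_ten (k := k) hJ
    rw [setting_supNorm_ten]
    refine domCert_of_family _ _ (ι := Bnd n M × Bnd n M)
      (fun bb => if bb.1.2 = bb.2.2 ∧ distU n M bb.1.1 bb.2.1 ≤ 1 ∧ 0 < distU n M bb.1.1 bb.2.1
        then (distU n M bb.1.1 bb.2.1 ^ α)⁻¹ * |ζ bb.2.1 * (GR n M a *ᵥ divTR n M T) (bb.2.1, bb.1.2)
          - ζ bb.1.1 * (GR n M a *ᵥ divTR n M T) (bb.1.1, bb.1.2)| else 0)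
      hs (norm_nonneg T) (fun bb => ?_) ?_
    · by_cases hadm : bb.1.2 = bb.2.2 ∧ distU n M bb.1.1 bb.2.1 ≤ 1 ∧ 0 < distU n M bb.1.1 bb.2.1
      · rw [if_pos hadm]
        by_cases hT0 : ‖T‖ = 0
        · have hT00 : T = 0 := norm_eq_zero.mp hT0
          refine ⟨true, sitePt M y, sitePt M y', 0, hdist, ?_⟩
          rw [hT00, divTR_zero, Matrix.mulVec_zero, Pi.zero_apply, Pi.zero_apply, mul_zero, mul_zero, sub_zero, abs_zero,
            mul_zero]
          exact dominated_zero _ _ _ _ _ κ _ _ hs (norm_nonneg _) hA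
        by_cases hζ0 : cutHL n M α ζ = 0
        · refine ⟨true, sitePt M y, sitePt M y', 0, hdist, ?_⟩
          rw [cut_eq_zero_of_cutHL hζ0, cut_eq_zero_of_cutHL hζ0, zero_mul, zero_mul, sub_zero, abs_zero, mul_zero]
          exact dominated_zero _ _ _ _ _ κ _ _ hs (norm_nonneg _) hA
        refine ⟨false, sitePt M y', sitePt M y,
          toLp 1 ((‖T‖ / cutHL n M α ζ * (distU n M bb.1.1 bb.2.1 ^ α)⁻¹) • cutSrc n M ζ bb.1.2 bb.1.1 bb.2.1), hdist', ?_⟩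
        show Dominated ρa.G ρa.H ρa.Dg (ctr M M₀) (κ.cbar * M₀) κ _ _ _ _ _
          (toLp 1 ((‖T‖ / cutHL n M α ζ * (distU n M bb.1.1 bb.2.1 ^ α)⁻¹) • cutSrc n M ζ bb.1.2 bb.1.1 bb.2.1)) _
        rw [hGa, hHa, hDa]
        exact dominated_quotH_adj k κ hn ha hM₀ hC hG hcb hcF hcL hc1 hT' hT0 hα0 hα1 hζ' hζ0 bb.1.2 hadm.2.1 hadm.2.2
      · refine ⟨true, sitePt M y, sitePt M y', 0, hdist, ?_⟩
        rw [if_neg hadm]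
        exact dominated_zero _ _ _ _ _ κ _ _ hs (norm_nonneg T) hA
    · intro B hB h
      show holderV n M α (smulV n M ζ ((DeltaA n M a)⁻¹ *ᵥ
        divT n M (fun ν => cplx (T ν)))) ≤ B
      rw [← cplx_divTR, ← cplx_GR_mulVec]
      unfold holderV LatticeNorms.holderSeminormB5
      refine LatticeNorms.holderSeminorm_le hB ?_
      rintro ⟨x, μ⟩ - ⟨x', μ'⟩ - ⟨hμ, h1⟩ h0
      simp only at hμ h1 h0
      subst hμ
      have hi := h ((x, μ), (x', μ))
      rw [if_pos ⟨rfl, h1, h0⟩] at hi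
      show ‖(ζ x' : ℂ) * (((GR n M a *ᵥ divTR n M T) (x', μ) : ℝ) : ℂ) - (ζ x : ℂ) * (((GR n M a *ᵥ divTR n M T) (x, μ) : ℝ) : ℂ)‖
        ≤ B * distU n M x x' ^ α
      rw [show (ζ x' : ℂ) * (((GR n M a *ᵥ divTR n M T) (x', μ) : ℝ) : ℂ) - (ζ x : ℂ) * (((GR n M a *ᵥ divTR n M T) (x, μ) : ℝ) : ℂ)
          = ((ζ x' * (GR n M a *ᵥ divTR n M T) (x', μ) - ζ x * (GR n M a *ᵥ divTR n M T) (x, μ) : ℝ) : ℂ) by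
          push_cast; ring, Complex.norm_real, Real.norm_eq_abs]
      exact le_mul_rpow_of_inv_mul_le h0 hi
  | ten2 T2 =>
    exact domCert_zero _ _ hs hm0

/-- **`certE4` FOR THE SETTING OF RECORD**: (1.112) `sup|∇G∇*J|` (tensor source, direct walk), `0` elsewhere.
[cite: Balaban1984PropagatorsI, (1.112) p.36, (1.123) p.37, (1.125), (1.129)–(1.131) p.38] -/
theorem certE4_holds (hGd : ρd.G = Gs n M a) (hHd : ρd.H = Hs n M M₀) (hDd : ρd.Dg = Dgs n M)
    (hn : 1 ≤ n) (hM₀ : 1 ≤ M₀)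
    (hcb : 11 / 3 ≤ κ.cbar) (hcF : cFmax d ≤ κ.cF) (hcL : cLmax d ≤ κ.cL) (hc1 : c1max d ≤ κ.c1) :
    ∀ (C : ℝ) (Cα Cε : ℝ → ℝ) (Cαε : ℝ → ℝ → ℝ), 0 < C →
      B5.Global115_117 (latticeSettingP12R n M a k) (gP12R M n a k) C Cα Cε Cαε →
      ∀ (ε : ℝ) (J : (latticeSettingP12R n M a k).Loc) (y y' : (latticeSettingP12R n M a k).Site), 0 < ε → ε < 1 →
        (latticeSettingP12R n M a k).suppIn J y' →
        DomCert (ctr M M₀) (repPair ρd ρa) (env C 0 (Cε ε) 0 0) 1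
          ((latticeSettingP12R n M a k).holder ε J + (latticeSettingP12R n M a k).supNorm J)
          ((latticeSettingP12R n M a k).dist y y') ((latticeSettingP12R n M a k).e4 J y) := by
  intro C Cα Cε Cαε hC hG ε J y y' hε0 hε1 hJ
  have hA : 0 ≤ env C 0 (Cε ε) 0 0 := le_trans zero_le_one (one_le_env C 0 (Cε ε) 0 0)
  have hm0 : 0 ≤ (latticeSettingP12R n M a k).holder ε J + (latticeSettingP12R n M a k).supNorm J :=
    add_nonneg (holderL_nonneg _ _) (supNormL_nonneg _)
  have hdist : (latticeSettingP12R n M a k).dist y y' ≤ dist (sitePt M y) (sitePt M y') := distSite_le_dist_sitePt M y y'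
  cases J with
  | vec Jv => exact domCert_zero _ _ zero_le_one hm0
  | ten T =>
    have hT' := supp_ten (k := k) hJ
    have hm : (latticeSettingP12R n M a k).holder ε (LocR.ten T) + (latticeSettingP12R n M a k).supNorm (LocR.ten T)
        = holderT n M ε (fun ν => cplx (T ν)) + ‖T‖ := by rw [setting_supNorm_ten]; rfl
    rw [hm]
    rw [hm] at hm0
    refine domCert_of_family _ _ (ι := Fin d × Bnd n M)
      (fun p => if p.2.1 ∈ cubeT n M y then |gradR n M (GR n M a *ᵥ divTR n M T) p.1 p.2| else 0)
      zero_le_one hm0 (fun p => ?_) ?_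
    · by_cases hb : p.2.1 ∈ cubeT n M y
      · refine ⟨true, sitePt M y, sitePt M y', divTR n M T, hdist, ?_⟩
        rw [if_pos hb]
        show Dominated ρd.G ρd.H ρd.Dg (ctr M M₀) (κ.cbar * M₀) κ _ _ _ _ _ (divTR n M T) _
        rw [hGd, hHd, hDd]
        exact dominated_grad_ten k κ hn hM₀ hC hG hcb hcF hcL hc1 hT' hε0 hε1 p.1 hb
      · refine ⟨true, sitePt M y, sitePt M y', 0, hdist, ?_⟩
        rw [if_neg hb]
        exact dominated_zero _ _ _ _ _ κ _ _ zero_le_one hm0 hA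
    · intro B hB h
      show LatticeNorms.supNorm (Finset.univ ×ˢ cubeB n M y)
        (fun p : Fin d × (Tor (fine n M) × Fin d) => grad n M
          ((DeltaA n M a)⁻¹ *ᵥ divT n M (fun ν => cplx (T ν))) p.1 p.2) ≤ B
      refine LatticeNorms.supNorm_le hB fun p hp => ?_
      have hb1 : p.2.1 ∈ cubeT n M y := mem_cubeB_iff.mp (Finset.mem_product.mp hp).2
      have := h p
      rw [if_pos hb1] at this
      show ‖grad n M ((DeltaA n M a)⁻¹ *ᵥ
        divT n M (fun ν => cplx (T ν))) p.1 p.2‖ ≤ B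
      rw [← cplx_divTR, ← cplx_GR_mulVec, ← cplx_gradR]
      show ‖((gradR n M (GR n M a *ᵥ divTR n M T) p.1 p.2 : ℝ) : ℂ)‖ ≤ B
      rwa [Complex.norm_real, Real.norm_eq_abs]
  | ten2 T2 => exact domCert_zero _ _ zero_le_one hm0

/-- **`certH2` FOR THE SETTING OF RECORD**: (1.113) `‖ζ∇G∇*J‖_α` (tensor source, direct walk, one problem per admissible pair),
`0` elsewhere. [cite: Balaban1984PropagatorsI, (1.113) p.36, (1.123) p.37, (1.125), (1.129)–(1.131) p.38] -/
theorem certH2_holds (hGd : ρd.G = Gs n M a) (hHd : ρd.H = Hs n M M₀) (hDd : ρd.Dg = Dgs n M)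
    (hn : 1 ≤ n) (hM₀ : 1 ≤ M₀)
    (hcb : 11 / 3 ≤ κ.cbar) (hcF : cFmax d ≤ κ.cF) (hcL : cLmax d ≤ κ.cL) (hc1 : c1max d ≤ κ.c1) :
    ∀ (C : ℝ) (Cα Cε : ℝ → ℝ) (Cαε : ℝ → ℝ → ℝ), 0 < C →
      B5.Global115_117 (latticeSettingP12R n M a k) (gP12R M n a k) C Cα Cε Cαε →
      ∀ (α ε : ℝ) (J : (latticeSettingP12R n M a k).Loc) (ζ : (latticeSettingP12R n M a k).Cut)
        (y y' : (latticeSettingP12R n M a k).Site), 0 ≤ α → 0 < ε → α + ε < 1 →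
        (latticeSettingP12R n M a k).cutIn ζ y → (latticeSettingP12R n M a k).suppIn J y' →
        DomCert (ctr M M₀) (repPair ρd ρa) (env C (Cα α) (Cε ε) (Cε (α + ε)) (Cαε α ε))
          ((latticeSettingP12R n M a k).cutH α ζ)
          ((latticeSettingP12R n M a k).holder (α + ε) J + (latticeSettingP12R n M a k).supNorm J)
          ((latticeSettingP12R n M a k).dist y y') ((latticeSettingP12R n M a k).h2 J α ζ) := by
  intro C Cα Cε Cαε hC hG α ε J ζ y y' hα0 hε0 hαε hζ hJ
  have hA : 0 ≤ env C (Cα α) (Cε ε) (Cε (α + ε)) (Cαε α ε) := le_trans zero_le_one (one_le_env _ _ _ _ _)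
  have hm0 : 0 ≤ (latticeSettingP12R n M a k).holder (α + ε) J + (latticeSettingP12R n M a k).supNorm J :=
    add_nonneg (holderL_nonneg _ _) (supNormL_nonneg _)
  have hs : 0 ≤ (latticeSettingP12R n M a k).cutH α ζ := cutHL_nonneg α ζ
  have hdist : (latticeSettingP12R n M a k).dist y y' ≤ dist (sitePt M y) (sitePt M y') := distSite_le_dist_sitePt M y y'
  have hζ' : cutInL n M ζ y := hζ
  cases J with
  | vec Jv => exact domCert_zero _ _ hs hm0
  | ten T =>
    have hT' := supp_ten (k := k) hJ
    have hm : (latticeSettingP12R n M a k).holder (α + ε) (LocR.ten T) + (latticeSettingP12R n M a k).supNorm (LocR.ten T)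
        = holderT n M (α + ε) (fun ν => cplx (T ν)) + ‖T‖ := by rw [setting_supNorm_ten]; rfl
    rw [hm]
    rw [hm] at hm0
    refine domCert_of_family _ _ (ι := (Fin d × Bnd n M) × (Fin d × Bnd n M))
      (fun pp => if pp.1.1 = pp.2.1 ∧ pp.1.2.2 = pp.2.2.2 ∧ distU n M pp.1.2.1 pp.2.2.1 ≤ 1 ∧ 0 < distU n M pp.1.2.1 pp.2.2.1
        then (distU n M pp.1.2.1 pp.2.2.1 ^ α)⁻¹ * |ζ pp.2.2.1 * gradR n M (GR n M a *ᵥ divTR n M T) pp.1.1 (pp.2.2.1, pp.1.2.2)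
          - ζ pp.1.2.1 * gradR n M (GR n M a *ᵥ divTR n M T) pp.1.1 (pp.1.2.1, pp.1.2.2)| else 0)
      hs hm0 (fun pp => ?_) ?_
    · by_cases hadm : pp.1.1 = pp.2.1 ∧ pp.1.2.2 = pp.2.2.2 ∧ distU n M pp.1.2.1 pp.2.2.1 ≤ 1 ∧ 0 < distU n M pp.1.2.1 pp.2.2.1
      · refine ⟨true, sitePt M y, sitePt M y', divTR n M T, hdist, ?_⟩
        rw [if_pos hadm]
        show Dominated ρd.G ρd.H ρd.Dg (ctr M M₀) (κ.cbar * M₀) κ _ _ _ _ _ (divTR n M T) _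
        rw [hGd, hHd, hDd]
        exact dominated_quotH_ten k κ hn hM₀ hC hG hcb hcF hcL hc1 hT' hα0 hε0 hαε hζ' pp.1.1 pp.1.2.2 hadm.2.2.1 hadm.2.2.2
      · refine ⟨true, sitePt M y, sitePt M y', 0, hdist, ?_⟩
        rw [if_neg hadm]
        exact dominated_zero _ _ _ _ _ κ _ _ hs hm0 hA
    · intro B hB h
      show holderT n M α (smulT n M ζ (grad n M
        ((DeltaA n M a)⁻¹ *ᵥ divT n M (fun ν => cplx (T ν))))) ≤ B
      rw [← cplx_divTR, ← cplx_GR_mulVec]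
      unfold holderT LatticeNorms.holderSeminormB5
      refine LatticeNorms.holderSeminorm_le hB ?_
      rintro ⟨ν, x, μ⟩ - ⟨ν', x', μ'⟩ - ⟨⟨hν, hμ⟩, h1⟩ h0
      simp only at hν hμ h1 h0
      subst hν hμ
      have hi := h ((ν, (x, μ)), (ν, (x', μ)))
      rw [if_pos ⟨rfl, rfl, h1, h0⟩] at hi
      show ‖(ζ x' : ℂ) * grad n M (cplx (GR n M a *ᵥ divTR n M T)) ν (x', μ)
        - (ζ x : ℂ) * grad n M (cplx (GR n M a *ᵥ divTR n M T)) ν (x, μ)‖ ≤ B * distU n M x x' ^ α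
      rw [← cplx_gradR]
      show ‖(ζ x' : ℂ) * ((gradR n M (GR n M a *ᵥ divTR n M T) ν (x', μ) : ℝ) : ℂ)
        - (ζ x : ℂ) * ((gradR n M (GR n M a *ᵥ divTR n M T) ν (x, μ) : ℝ) : ℂ)‖ ≤ B * distU n M x x' ^ α
      rw [show (ζ x' : ℂ) * ((gradR n M (GR n M a *ᵥ divTR n M T) ν (x', μ) : ℝ) : ℂ)
          - (ζ x : ℂ) * ((gradR n M (GR n M a *ᵥ divTR n M T) ν (x, μ) : ℝ) : ℂ)
          = ((ζ x' * gradR n M (GR n M a *ᵥ divTR n M T) ν (x', μ)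
            - ζ x * gradR n M (GR n M a *ᵥ divTR n M T) ν (x, μ) : ℝ) : ℂ) by push_cast; ring, Complex.norm_real, Real.norm_eq_abs]
      exact le_mul_rpow_of_inv_mul_le h0 hi
  | ten2 T2 => exact domCert_zero _ _ hs hm0

/-! ## §3 The realisation from the two representations -/

/-- **THE SUP/HÖLDER REALISATION OF THE SETTING OF RECORD FROM ITS TWO REPRESENTATIONS** (direct (1.123) on `ℓ^∞`, adjoint on
`ℓ¹`, p. 39), the cube geometry of `B5WalkTorusGeom` (multiplicity `(8c̄+1)^d`, row sum `K_d(¼)`) and the four certificates above.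
[cite: Balaban1984PropagatorsI, pp.36–39, (1.110)–(1.113) pp.35–36, (1.125), (1.129)–(1.131) p.38] -/
def supRealisationR (hGd : ρd.G = Gs n M a) (hHd : ρd.H = Hs n M M₀) (hDd : ρd.Dg = Dgs n M)
    (hGa : ρa.G = G1 n M a) (hHa : ρa.H = H1 n M M₀) (hDa : ρa.Dg = Dg1 n M)
    (hn : 1 ≤ n) (ha : 0 < a) (hM₀ : 1 ≤ M₀)
    (hcb : 11 / 3 ≤ κ.cbar) (hnu : (8 * κ.cbar + 1) ^ d ≤ κ.nu) (hK : latticeConst d (1 / 4) ≤ κ.Kbar)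
    (hcF : cFmax d ≤ κ.cF) (hcL : cLmax d ≤ κ.cL) (hc1 : c1max d ≤ κ.c1) :
    SupRealisation (latticeSettingP12R n M a k) kd (gP12R M n a k) M₀ κ Bool (CarV n M) (CarVg n M) (TorR M) (Cen M M₀) where
  ctr := ctr M M₀
  rep := repPair ρd ρa
  hν := fun x => (card_near_ctr_le M hM₀ (le_trans (by norm_num) hcb) x).trans hnu
  hrow := fun z => (rowSum_ctr_le M hM₀ z).trans hK
  certSup := certSup_holds κ ρd ρa hGd hHd hDd hGa hHa hDa hn ha hM₀ hcb hcF hcL hc1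
  certH1 := certH1_holds κ ρd ρa hGd hHd hDd hGa hHa hDa hn ha hM₀ hcb hcF hcL hc1
  certE4 := certE4_holds κ ρd ρa hGd hHd hDd hn hM₀ hcb hcF hcL hc1
  certH2 := certH2_holds κ ρd ρa hGd hHd hDd hn hM₀ hcb hcF hcL hc1

end Certs

end

end Literature.MathematicalPhysics.QuantumFieldTheory.Balaban1983to89.B5SupCertsTorus
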